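import Literature.AnabelianGeometry.AbsoluteAnabelian.AbsTopIII.CurveModelOncePuncturedTorusPropOneFour
import Literature.AnabelianGeometry.AbsoluteAnabelian.AbsTopIII.CcnSynchronizationModel
import HarnessLib

/-!
# [AbsTopIII] Prop. 1.4 (i): K4 re-close of cone node `AbsTopIII:Prop1.4(i)` at the once-punctured torus

Mochizuki, *Topics in Absolute Anabelian Geometry III*, §1, Prop. 1.4 (i)/(ii), manuscript p. 31 (lit key
`paper:url-5493eb38cbb7`): "the kernels of the natural surjections `Δ_U ↠ Δ_{U_x}`, `Π_U ↠ Π_{U_x}` are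
topologically normally generated by the inertia groups" (i) and "we have a natural exact sequence of
profinite groups `1 → I_x → Δ^{c-cn}_{U_x} → Δ_X → 1`" (ii).

PROOF-ONLY file (cell abc-iut, seat abc-iut-f-095 gen 12, row «K4B6», director-abc KEY 2026-08-27T07:16:54Z;
no `def`, no instance, no new named fact).  CONTEXT (abc-iut-c312-2 `CONE-K4-RECLOSE.tsv` v4, class
BLOCKED): the node's two closers `CurveModel.surjOn_geom_res` / `CurveModel.nonempty_ccnSection_res`
(`CcnSynchronizationModel.lean`) bind the model-relative named fact `h14 : M.Prop_1_4_i'` (FACT-LIST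
F-0340), whose universal closure `∀ M, M.Prop_1_4_i'` is REFUTED (`CurveModelSchemaWitnesses.lean`), and the
producers census found no theorem with conclusion head `Prop_1_4_i'` — the only genuine-`Δ` inhabitant in
tree, abc-iut-f-076's `CurveModel.exists_oncePuncturedTorus_prop_1_4`, is an `∃`-statement.  THIS FILE
applies the two closers AT that inhabitant: at the once-punctured-torus model (`k = ℚ̄`, `Π_{U_x} = Δ_{U_x}
= F̂₂`, one cusp `x` with `I_x = ⟨[a,b]⟩⁻`, `Π_X = F̂₂/⟨⟨[a,b]⟩⟩⁻`, `Δ_X ≠ 1`, `res` the quotient map)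
the binder `Prop_1_4_i'` is a THEOREM, hence so are the node's conclusions `Δ_{U_x} ↠ Δ_X` and
"continuous sections of `Δ^{c-cn}_{U_x} ↠ Δ_X` exist" — with ZERO named-fact hypotheses.

HONEST LABEL: a group-theoretic MODEL (profinite completion of a topological `π₁` over an algebraically
closed base, `Π = Δ`), not the étale `π₁` of a scheme; re-closed-at-a-model ≠ discharged at the intended
carrier; consistency evidence for OUR typing only; nothing here bears on [IUTchIII] Cor. 3.12 or asserts
that abc is proved or refuted.  Axioms standard.
-/

noncomputable section

namespace Literature.AnabelianGeometry.AbsoluteAnabelian.AbsTopIII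

/-- **K4 re-close of `AbsTopIII:Prop1.4(i)` at the once-punctured torus.**  There is a model
`M : CurveModel` with a cofinite open `U_x ⊆ X` of scheme-like curves, `Δ_X ≠ 1`, at which the named fact
`Prop_1_4_i'` (F-0340) HOLDS and — feeding it to the node's closers `CurveModel.surjOn_geom_res` and
`CurveModel.nonempty_ccnSection_res` — `Π_{U_x} → Π_X` maps `Δ_{U_x}` onto `Δ_X` and the cuspidally
central extension `Δ^{c-cn}_{U_x} ↠ Δ_X` admits a continuous section.  Model = abc-iut-f-076's
once-punctured torus (`CurveModel.exists_oncePuncturedTorus_prop_1_4`).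
[cite: MochizukiAbsTopIII2015, Prop 1.4 (i) p.31] -/
theorem CurveModel.exists_oncePuncturedTorus_prop_1_4_i'_reclosed :
    ∃ (M : CurveModel.{0}) (Ux X : M.Curve) (h : M.IsCofiniteOpen Ux X),
      (M.ext X).geom ≠ ⊥ ∧ M.IsScheme Ux ∧ M.IsScheme X ∧ M.Prop_1_4_i' ∧
        Set.SurjOn (M.res h).arith (M.ext Ux).geom (M.ext X).geom ∧
          Nonempty (CcnSection (M.res h)) := by
  obtain ⟨M, Ux, X, h, x, hp, hne, -, h14, -⟩ := CurveModel.exists_oncePuncturedTorus_prop_1_4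
  exact ⟨M, Ux, X, h, hne, hp.isScheme.1, hp.isScheme.2, h14,
    M.surjOn_geom_res h14 h hp.isScheme.1 hp.isScheme.2,
    M.nonempty_ccnSection_res h14 h hp.isScheme.1 hp.isScheme.2⟩

/-- The same re-close together with the cyclotome presentation of the model: at the once-punctured
torus the presentation `(U_x ⊆ X, x)` is a cyclotome presentation (Prop. 1.4 (ii) exactness included),
`Prop_1_4_i` · `Prop_1_4_i'` · `Prop_1_4_ii` hold, and the node's conclusions follow from the closers.
[cite: MochizukiAbsTopIII2015, Prop 1.4 (i) p.31] -/
theorem CurveModel.exists_oncePuncturedTorus_cyclotomePresentation_reclosed :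
    ∃ (M : CurveModel.{0}) (Ux X : M.Curve) (h : M.IsCofiniteOpen Ux X) (x : (M.cusps Ux).Cusp),
      M.IsCyclotomePresentation h x ∧ (M.ext X).geom ≠ ⊥ ∧ M.Prop_1_4_i ∧ M.Prop_1_4_i' ∧ M.Prop_1_4_ii ∧
        Set.SurjOn (M.res h).arith (M.ext Ux).geom (M.ext X).geom ∧
          Nonempty (CcnSection (M.res h)) := by
  obtain ⟨M, Ux, X, h, x, hp, hne, h14i, h14, h14ii, -⟩ := CurveModel.exists_oncePuncturedTorus_prop_1_4
  exact ⟨M, Ux, X, h, x, hp, hne, h14i, h14, h14ii,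
    M.surjOn_geom_res h14 h hp.isScheme.1 hp.isScheme.2,
    M.nonempty_ccnSection_res h14 h hp.isScheme.1 hp.isScheme.2⟩

end Literature.AnabelianGeometry.AbsoluteAnabelian.AbsTopIII
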